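import Summits.BirchSwinnertonDyer.BirchSwinnertonDyer.Theorems.GenusKolyvaginAtTwoGenusPrimitiveSupplyAtTwoTwistSelmerStrictInherit
import Summits.BirchSwinnertonDyer.BirchSwinnertonDyer.Theorems.GenusKolyvaginAtTwoShaCardDvdPowAtTwoPosTOnCutRankQ
import Summits.BirchSwinnertonDyer.BirchSwinnertonDyer.Theorems.GenusKolyvaginAtTwoShaCardDvdPowAtTwoPosTOnCut
import Summits.BirchSwinnertonDyer.BirchSwinnertonDyer.Theorems.GenusKolyvaginAtTwoMazurRubinCor34iiDictionary
import Summits.BirchSwinnertonDyer.BirchSwinnertonDyer.Theorems.GenusKolyvaginAtTwoGenusPrimitiveSupplyAtTwoArchimedeanEgg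
import Literature.NumberTheory.EllipticCurves.TwoAdicImageQuadraticTwistProofs
import HarnessLib

/-!
# Route `GenusKolyvaginAtTwo`, crux 25504 (Δ>0 supply), `#Sel₂(E) = 1` cell: THE DEPTH-ZERO BIT IS ARCHIMEDEAN — on an all-silent Heegner
# twin with `2` split, every `2`-Selmer class of the twin that is STRICT AT `∞` vanishes (Claim B⁺, Selmer half; memo `R1POS-VACUOUS-gk2p5-g34.md` §3)

Seat `bsd-line-gk2-p5` g34 (cell `bsd-f1-sign2`, WIDTH-5 attach), `--supports stmt-BirchSwinnertonDyer-25504 --as helper`.  THEOREMS ONLY (no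
definition, no named fact, no `sorry`); UNCONDITIONAL.  **BSD is NOT proved by this file and no item is closed by it.**

WHY.  The Δ>0 reduction bit R₁⁺ (ramified prime `ℓ ∣ d_K`) is vacuous on the `#Sel₂(E) = 1` cell (p764232/p764449: the twin is all-silent).  On that
cell, when `2` splits in `K`, the Kummer local conditions of `E` and of the twin `Wd ≅ E^(d_K)` AGREE at every FINITE place (split at `2N_E`,
good–good at odd inert primes, silent–silent at the primes of `d_K`) and differ only at the REAL place (`Δ > 0`).  So a `2`-Selmer class of `Wd`
with zero localisation at `∞` transports (Mazur–Rubin Prop. 3.3, first display, `T = {∞}`, read twin → curve) into the transported Selmer group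
`H¹_{φ_*𝓚_E}`, which has the order of `Sel₂(E) = 0`; hence it is `0`, and the non-trivial class of `Sel₂(Wd) ≅ ℤ/2` localises NON-trivially
at `∞` — the generator of `Wd(ℚ)/2` (the twin Heegner point when `M₀ = 0`) is NOT `2`-divisible in `Wd(ℝ)`: it lies on the non-identity real
component.  This is the Δ>0 analogue of gk2-p4 g25's p763963 / my p763895 (there `T = {ℓ₀}`); the E-side real-component reading is left to
the instrument I1⁺ (the sign of the Heegner point's real coordinate relative to `2Wd(ℝ) = Wd(ℝ)⁰`).

* §1 (any number field, any twist pair, ONE INFINITE place `w₀`): `twin_selmer_eq_zero_of_localization_inl_eq_zero_of_natCard_eq_one_of_menu₃` —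
  three-row finite menu (split ∨ good–good `∤ 2` ∨ silent–silent `∤ 2`) at EVERY finite place, split ∨ `H¹ = 0` at the other infinite places,
  `#Sel₂(W') = 1` for the twist partner ⟹ every class of `Sel₂(W)` with `loc_{w₀} = 0` is `0`.
* §2 (`ℚ`, all-silent Heegner twin, `2` split): `menu₃_finite_rat_of_allSilent_of_two_split`; **`twin_selmer_eq_zero_of_localization_real_eq_zero`**
  and **`exists_twin_selmer_localization_real_ne_zero`** (`#Sel₂(W) = 1`, `#Sel₂(Wd) = 2` ⟹ some class of `Sel₂(Wd)` has `loc_∞ ≠ 0`).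

References: [MazurRubin2010] Def. 3.1, Lemma 2.2 (i), Lemma 2.10, Prop. 3.3, Cor. 3.4 (i); [Kramer1981] §2 Prop. 3, Thm. 1; [GrossLMS1991] §1, §5 Prop. 5.3;
[SilvermanAEC2009] X.2 Prop. 2.4, X.5 Cor. 5.4.
-/

set_option linter.dupNamespace false -- `Summit.<P>.<Sub>` repeats `BirchSwinnertonDyer` (D-0017)
set_option autoImplicit false

noncomputable section

open scoped Classical ContRepresentation

namespace Summit.BirchSwinnertonDyer.BirchSwinnertonDyer.Theorems.GenusSupplyNarrow.ArchBit

open WeierstrassCurve Field NumberField IsDedekindDomain Function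
open Literature.NumberTheory.EllipticCurves Literature.NumberTheory.GaloisRepresentations
open Literature.NumberTheory.GaloisRepresentations.DiscreteGaloisModule (SelmerStructure)
open Literature.NumberTheory.GaloisCohomology
open Summit.BirchSwinnertonDyer.Rank1Residual.X11b.CongruentTransfer
open Summit.BirchSwinnertonDyer.Rank1Residual.X11b.KummerPT (kummerStrict kummerRelaxed kummerStrict_of_mem
  kummerStrict_of_not_mem)
open Rat.HeightOneSpectrum (primesEquiv natGenerator)
open Summit.BirchSwinnertonDyer.BirchSwinnertonDyer.Theorems.GenusKolyTwistLocal
open Summit.BirchSwinnertonDyer.BirchSwinnertonDyer.Theorems.GenusExact.PlusDescent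

/-! ## §1 Strict-at-one-infinite-place classes transport into the twist partner (any number field) -/

section Generic

variable {K : Type} [Field K] [NumberField K] (W : WeierstrassCurve K) [W.IsElliptic]

/-- **Mazur–Rubin Prop. 3.3 (first display) with `T = {w₀}` ONE INFINITE place, read for a single class, twin → partner.**  `W` elliptic over a
number field `K`, `d ≠ 0`, `W'` ANY elliptic model of `W^{(d)}`; HYPOTHESES: every finite place is split (`d ∈ (K_v^×)²`) or good for both with
`v ∤ 2` or silent for both with `v ∤ 2`; every infinite place other than `w₀` is split or has `H¹ = 0` for both; and `#Sel₂(W') = 1`.  THEN every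
class `c ∈ Sel₂(W)` with `loc_{w₀} c = 0` is `0`: `c` lies in the strict group `Sel_{w₀}(W)`, which is contained in the transported group
`H¹_{φ_*𝓚_{W'}}` (agreement off `w₀`), of order `#Sel₂(W') = 1`.  Nothing is assumed AT `w₀`; no print fact.
[cite: MazurRubin2010, Lemma 2.10, Prop. 3.3, Cor. 3.4 (i) (arXiv:0904.3709 pp. 8–10)] -/
theorem twin_selmer_eq_zero_of_localization_inl_eq_zero_of_natCard_eq_one_of_menu₃
    {d : K} (hd : d ≠ 0) {W' : WeierstrassCurve K} [W'.IsElliptic] {C : VariableChange K}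
    (hW' : C • W.quadraticTwist d = W') (w₀ : InfinitePlace K)
    (hfin : ∀ v : HeightOneSpectrum (𝓞 K),
      (∃ s : v.adicCompletion K, s ^ 2 = algebraMap K (v.adicCompletion K) d) ∨
      (((2 : ℕ) : 𝓞 K) ∉ v.asIdeal ∧ W.HasGoodReductionAt v ∧ W'.HasGoodReductionAt v) ∨
      (((2 : ℕ) : 𝓞 K) ∉ v.asIdeal ∧
        Nat.card (nsmulAddMonoidHom 2 : (W.baseChange (v.adicCompletion K)).toAffine.Point →+ _).ker = 1 ∧
        Nat.card (nsmulAddMonoidHom 2 : (W'.baseChange (v.adicCompletion K)).toAffine.Point →+ _).ker = 1))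
    (hinf : ∀ w : InfinitePlace K, w ≠ w₀ →
      (∃ s : w.Completion, s ^ 2 = algebraMap K w.Completion d) ∨
      ((∀ x : galoisCohomology (W.localGaloisModule w.Completion) 1, x = 0) ∧
        (∀ x : galoisCohomology (W'.localGaloisModule w.Completion) 1, x = 0)))
    (h1 : Nat.card (W'.selmerGroup ((2 : ℕ) : ℤ)) = 1)
    {c : galoisCohomology (W.torsionGaloisModule ((2 : ℕ) : ℤ)) 1}
    (hc : c ∈ (W.kummerSelmerStructure ((2 : ℕ) : ℤ)).selmerGroup)
    (h0 : galoisCohomology.localization (W.torsionGaloisModule ((2 : ℕ) : ℤ)) (Sum.inl w₀) 1 c = 0) :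
    c = 0 := by
  haveI : NeZero (2 : K) := ⟨two_ne_zero⟩
  haveI : Fact (Nat.Prime 2) := ⟨Nat.prime_two⟩
  obtain ⟨φ, ψ, hψφ, hφψ, hsplit⟩ := exists_intertwining_hsplit W hd hW'
  -- the transported Kummer structure of `W'`
  let 𝓐 : SelmerStructure (W.torsionGaloisModule ((2 : ℕ) : ℤ)) := fun v ↦
    (W'.kummerSelmerStructure ((2 : ℕ) : ℤ) v).map
      (galoisCohomology.map (φ.restrictField (Place.Completion v)) 1)
  have h𝓐 : ∀ v, 𝓐 v = (W'.kummerSelmerStructure ((2 : ℕ) : ℤ) v).map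
      (galoisCohomology.map (φ.restrictField (Place.Completion v)) 1) := fun _ ↦ rfl
  set S : Finset (Place K) := {(Sum.inl w₀ : Place K)} with hSdef
  -- agreement off `S`
  have hagree : ∀ v ∉ S, 𝓐 v = W.kummerSelmerStructure ((2 : ℕ) : ℤ) v := by
    rintro (w | v) hv
    · have hw : w ≠ w₀ := fun h ↦ hv (by rw [hSdef, h, Finset.mem_singleton])
      rcases hinf w hw with ⟨s, hs⟩ | ⟨hW, hW'⟩
      · rw [h𝓐, kummerSelmerStructure_apply, kummerSelmerStructure_apply]
        exact hsplit (Place.Completion (Sum.inl w)) ⟨s, hs⟩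
      · rw [h𝓐, kummerSelmerStructure_apply, kummerSelmerStructure_apply]
        exact map_kummerLocalConditionAt_eq_of_eq_top W W' ((2 : ℕ) : ℤ) (Place.Completion (Sum.inl w)) φ ψ hφψ
          (kummerLocalConditionAt_eq_top_of_forall_eq_zero W' _ _ hW')
          (kummerLocalConditionAt_eq_top_of_forall_eq_zero W _ _ hW)
    · rcases hfin v with ⟨s, hs⟩ | ⟨h2v, hvW, hvW'⟩ | ⟨h2v, h1W, h1W'⟩
      · rw [h𝓐, kummerSelmerStructure_apply, kummerSelmerStructure_apply]
        exact hsplit (Place.Completion (Sum.inr v)) ⟨s, hs⟩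
      · exact transport_kummer_inr_eq_of_good W W' 2 φ ψ hφψ 𝓐 h𝓐 h2v hvW hvW'
      · rw [h𝓐, kummerSelmerStructure_apply, kummerSelmerStructure_apply]
        exact map_kummerLocalConditionAt_adicCompletion_eq_of_natCard_ker_eq_one W W' v two_ne_zero h2v h1W h1W' φ
  -- `c` is strict at `w₀`, hence in `H¹_𝓐`
  have hcS : c ∈ (kummerStrict W 2 S).selmerGroup :=
    mem_selmerGroup_kummerStrict_of_forall_localization_eq_zero W 2 S hc fun v hv ↦ by
      have hv' : v = Sum.inl w₀ := by simpa [hSdef] using hv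
      subst hv'
      exact h0
  have hc𝓐 : c ∈ 𝓐.selmerGroup := (selmerGroup_sandwich_of_agree W 2 S hagree).1 hcS
  -- `#H¹_𝓐 = #Sel₂(W') = 1`
  have hcard : Nat.card 𝓐.selmerGroup = 1 := by
    rw [natCard_selmerGroup_transport_kummer W W' 2 φ ψ hψφ hφψ 𝓐 h𝓐]
    exact h1
  have hbot : 𝓐.selmerGroup = ⊥ := AddSubgroup.eq_bot_of_card_eq _ hcard
  rw [hbot, AddSubgroup.mem_bot] at hc𝓐
  exact hc𝓐

end Generic

/-! ## §2 The all-silent Heegner twin over `ℚ` with `2` split: the non-trivial `2`-Selmer class of the twin lives at `∞` -/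

section Rat

variable (W : WeierstrassCurve ℚ) [W.IsElliptic] [W.IsGloballyMinimal]

omit [W.IsElliptic] [W.IsGloballyMinimal] in
/-- **`Wd ≅ W^{(d)} ⟹ W ≅ Wd^{(d)}`** (`d ≠ 0`).  Private copy of `TwoAdicTwistConverse.exists_variableChange_quadraticTwist_symm` (same proof;
heavy import avoided). [cite: SilvermanAEC2009, X.2 Prop. 2.4 and X.5 Cor. 5.4] -/
private theorem exists_variableChange_quadraticTwist_symm {d : ℚ} (hd : d ≠ 0) {A : WeierstrassCurve ℚ}
    {C : VariableChange ℚ} (hA : C • W.quadraticTwist d = A) : ∃ C' : VariableChange ℚ, C' • A.quadraticTwist d = W := by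
  obtain ⟨C₁, hC₁⟩ := W.exists_variableChange_quadraticTwist_one
  obtain ⟨C₂, hC₂⟩ := W.exists_variableChange_quadraticTwist_mul_sq (1 : ℚ) d hd
  have h3 : A.quadraticTwist d = (⟨C.u, d * C.r, 0, 0⟩ : VariableChange ℚ) • (C₂ • C₁ • W) := by
    rw [← hA, quadraticTwist_smul, quadraticTwist_quadraticTwist, hC₁, hC₂]
    congr 1
    ring
  have h4 : A.quadraticTwist d = ((⟨C.u, d * C.r, 0, 0⟩ : VariableChange ℚ) * C₂ * C₁) • W := by
    rw [h3, mul_smul, mul_smul]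
  refine ⟨((⟨C.u, d * C.r, 0, 0⟩ : VariableChange ℚ) * C₂ * C₁)⁻¹, ?_⟩
  rw [h4, inv_smul_smul]

/-- **The three-row finite menu for an ALL-SILENT Heegner twin with `2` split, read twin → curve.**  `W/ℚ` globally minimal with `C(W)` odd, `K`
imaginary quadratic with odd `d_K`, Heegner for `N_W`, `2` split in `K`, `Wd = Cd • W^(d_K)` elliptic with `ord₂ C(Wd) = 0`: at every finite place
`v` of `ℚ` — over a prime of `2N_W`: split; over a prime of `d_K`: silent for `Wd` and for `W` (`ord₂ C(Wd) = 0` ⟹ `W(ℚ_ℓ)[2] = 0`,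
`forall_twoTorsion_padic_eq_zero_of_padicValNat_two_tamagawaProduct_twin_eq_zero`, and `#Wd(ℚ_ℓ)[2] = #W(ℚ_ℓ)[2]`); otherwise good for both.
[cite: MazurRubin2010, Prop. 3.3 (hypotheses), Lemma 2.10 (i)–(ii)] [cite: Kramer1981, §2 Prop. 3] [cite: GrossLMS1991, §1 (p. 235)] -/
theorem menu₃_finite_rat_of_allSilent_of_two_split {K : Type} [Field K] [NumberField K]
    (hK : IsImaginaryQuadratic K) (hodd : Odd (discr K)) (hH : SatisfiesHeegnerHypothesis (W.conductorNorm ℤ) K)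
    (h2K : ((Ideal.span {(2 : ℤ)}).primesOver (𝓞 K)).ncard = 2) (hTam : Odd W.tamagawaProduct)
    {Wd : WeierstrassCurve ℚ} [Wd.IsElliptic] (Cd : VariableChange ℚ) (hCd : Cd • W.quadraticTwist (discr K : ℚ) = Wd)
    (hDEF : padicValNat 2 Wd.tamagawaProduct = 0) :
    ∀ v : HeightOneSpectrum (𝓞 ℚ),
      (∃ s : v.adicCompletion ℚ, s ^ 2 = algebraMap ℚ (v.adicCompletion ℚ) (discr K : ℚ)) ∨
      (((2 : ℕ) : 𝓞 ℚ) ∉ v.asIdeal ∧ Wd.HasGoodReductionAt v ∧ W.HasGoodReductionAt v) ∨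
      (((2 : ℕ) : 𝓞 ℚ) ∉ v.asIdeal ∧
        Nat.card (nsmulAddMonoidHom 2 : (Wd.baseChange (v.adicCompletion ℚ)).toAffine.Point →+ _).ker = 1 ∧
        Nat.card (nsmulAddMonoidHom 2 : (W.baseChange (v.adicCompletion ℚ)).toAffine.Point →+ _).ker = 1) := by
  intro v
  haveI := Fact.mk (primesEquiv v).2
  set p : ℕ := ((primesEquiv v : Nat.Primes) : ℕ) with hp
  have hpP : p.Prime := (primesEquiv v).2
  have hpv : (p : 𝓞 ℚ) ∈ v.asIdeal := Rat.HeightOneSpectrum.natCast_natGenerator_mem v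
  have hd0 : (discr K : ℚ) ≠ 0 := by exact_mod_cast NumberField.discr_ne_zero K
  by_cases hsplit : p ∣ W.conductorNorm ℤ ∨ p = 2
  · -- `p` splits in `K`: `d_K` is a square in `ℚ_v`
    refine Or.inl (exists_sq_eq_discr_adicCompletion_of_ncard_primesOver hK.1 v ?_)
    rcases hsplit with hpN | hp2
    · exact hH p hpP hpN
    · rw [← hp, hp2]
      exact h2K
  · rw [not_or] at hsplit
    obtain ⟨hpN, hp2⟩ := hsplit
    have h2v : ((2 : ℕ) : 𝓞 ℚ) ∉ v.asIdeal :=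
      GenusKolyTwistingPrime.natCast_not_mem_of_not_dvd hpP hpv fun h ↦
        hp2 ((Nat.prime_dvd_prime_iff_eq hpP Nat.prime_two).mp h)
    have hW : W.HasGoodReductionAt v := by
      by_contra h
      exact hpN ((W.dvd_conductorNorm_iff v).mpr h)
    by_cases hpd : (p : ℤ) ∣ discr K
    · -- a prime of `d_K`: SILENT for `W` (all-silent twin) and for `Wd` (same local `2`-torsion count)
      have hsilW := forall_twoTorsion_padic_eq_zero_of_padicValNat_two_tamagawaProduct_twin_eq_zero W hK hodd hH hTam Cd hCd hDEF p hpd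
      have h1Wp : Nat.card {Q : (W.baseChange ℚ_[p]).toAffine.Point // 2 • Q = 0} = 1 := by
        rw [Nat.card_eq_one_iff_unique]
        exact ⟨⟨fun a b ↦ Subtype.ext ((hsilW a.1 a.2).trans (hsilW b.1 b.2).symm)⟩, ⟨⟨0, by simp⟩⟩⟩
      have h1Wdp : Nat.card {Q : (Wd.baseChange ℚ_[p]).toAffine.Point // 2 • Q = 0} = 1 := by
        rw [GenusKolyTwistTamagawa.natCard_twoTorsion_padic_twist_eq W hd0 hCd p, h1Wp]
      have h1W : Nat.card (nsmulAddMonoidHom 2 : (W.baseChange (v.adicCompletion ℚ)).toAffine.Point →+ _).ker = 1 := by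
        rw [natCard_ker_nsmul_adicCompletion_eq_padic W v 2]; exact h1Wp
      have h1Wd : Nat.card (nsmulAddMonoidHom 2 : (Wd.baseChange (v.adicCompletion ℚ)).toAffine.Point →+ _).ker = 1 := by
        rw [natCard_ker_nsmul_adicCompletion_eq_padic Wd v 2]; exact h1Wdp
      exact Or.inr (Or.inr ⟨h2v, h1Wd, h1W⟩)
    · -- `p ∤ 2 d_K N_W`: odd, good for `W` and for `Wd`
      have hpd' : ¬ ((p : ℕ) : ℤ) ∣ 2 * discr K := by
        intro h
        rcases (Nat.prime_iff_prime_int.mp hpP).dvd_or_dvd h with h2' | hd'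
        · exact hp2 ((Nat.prime_dvd_prime_iff_eq hpP Nat.prime_two).mp (by exact_mod_cast h2'))
        · exact hpd hd'
      exact Or.inr (Or.inl ⟨h2v, hasGoodReductionAt_of_smul_quadraticTwist W v hpd' hW hCd, hW⟩)

/-- **CLAIM B⁺, SELMER HALF: on the `#Sel₂(E) = 1` cell of the Δ>0 supply (all-silent twin, `2` split) every `2`-Selmer class of the twin that is
STRICT AT `∞` is `0`.**  `W/ℚ` globally minimal with `C(W)` odd and `#Sel₂(W) = 1`; `K` imaginary quadratic with odd `d_K`, Heegner for `N_W`,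
`2` split in `K`; `Wd = Cd • W^(d_K)` elliptic with `ord₂ C(Wd) = 0`.  Then for every `c ∈ Sel₂(Wd)`: `loc_∞ c = 0 ⟹ c = 0` (§1 for the pair
`(Wd, W)`, `W ≅ Wd^{(d_K)}`, the menu of `menu₃_finite_rat_of_allSilent_of_two_split`; `ℚ` has one infinite place).  No sign hypothesis on `Δ` is
needed for this direction; on `Δ < 0` the statement is empty of content (`H¹(ℝ, E[2]) = 0`), on `Δ > 0` it locates the twin's Selmer class at
the real place.  UNCONDITIONAL.  [cite: MazurRubin2010, Prop. 3.3, Cor. 3.4 (i)] [cite: Kramer1981, Thm. 1] -/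
theorem twin_selmer_eq_zero_of_localization_real_eq_zero {K : Type} [Field K] [NumberField K]
    (hK : IsImaginaryQuadratic K) (hodd : Odd (discr K)) (hH : SatisfiesHeegnerHypothesis (W.conductorNorm ℤ) K)
    (h2K : ((Ideal.span {(2 : ℤ)}).primesOver (𝓞 K)).ncard = 2) (hTam : Odd W.tamagawaProduct)
    (h1 : Nat.card (W.selmerGroup 2) = 1)
    {Wd : WeierstrassCurve ℚ} [Wd.IsElliptic] (Cd : VariableChange ℚ) (hCd : Cd • W.quadraticTwist (discr K : ℚ) = Wd)
    (hDEF : padicValNat 2 Wd.tamagawaProduct = 0)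
    {c : galoisCohomology (Wd.torsionGaloisModule ((2 : ℕ) : ℤ)) 1}
    (hc : c ∈ (Wd.kummerSelmerStructure ((2 : ℕ) : ℤ)).selmerGroup)
    (h0 : galoisCohomology.localization (Wd.torsionGaloisModule ((2 : ℕ) : ℤ)) (Sum.inl Rat.infinitePlace) 1 c = 0) :
    c = 0 := by
  have hd0 : (discr K : ℚ) ≠ 0 := by exact_mod_cast NumberField.discr_ne_zero K
  obtain ⟨C', hC'⟩ := exists_variableChange_quadraticTwist_symm W hd0 hCd
  have h1' : Nat.card (W.selmerGroup ((2 : ℕ) : ℤ)) = 1 := by rw [Nat.cast_ofNat]; exact h1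
  have hfin := menu₃_finite_rat_of_allSilent_of_two_split W hK hodd hH h2K hTam Cd hCd hDEF
  have hinf : ∀ w : InfinitePlace ℚ, w ≠ Rat.infinitePlace →
      (∃ s : w.Completion, s ^ 2 = algebraMap ℚ w.Completion (discr K : ℚ)) ∨
      ((∀ x : galoisCohomology (Wd.localGaloisModule w.Completion) 1, x = 0) ∧
        (∀ x : galoisCohomology (W.localGaloisModule w.Completion) 1, x = 0)) :=
    fun w hw ↦ absurd (Subsingleton.elim w _) hw
  exact twin_selmer_eq_zero_of_localization_inl_eq_zero_of_natCard_eq_one_of_menu₃ Wd hd0 hC' Rat.infinitePlace hfin hinf h1' hc h0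

/-- **The non-trivial `2`-Selmer class of the all-silent twin localises NON-trivially at `∞`** (same cell, plus `#Sel₂(Wd) = 2`): there is
`c ∈ Sel₂(Wd)` with `loc_∞ c ≠ 0` — Mazur–Rubin's `V_{{∞}} = loc_∞ Sel₂(Wd) ≠ 0`.  Reading for the instrument (memo §3): on this cell `Sel₂(Wd) =
Wd(ℚ)/2Wd(ℚ)` is spanned by the Kummer class of a generator (= the twin Heegner point when `M₀ = 0`), which is therefore NOT `2`-divisible in
`Wd(ℝ)`, i.e. lies off the identity component `Wd(ℝ)⁰ = 2Wd(ℝ)` (`Δ_{Wd} > 0`).  UNCONDITIONAL.  [cite: MazurRubin2010, Def. 3.1, Cor. 3.4 (i)] -/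
theorem exists_twin_selmer_localization_real_ne_zero {K : Type} [Field K] [NumberField K]
    (hK : IsImaginaryQuadratic K) (hodd : Odd (discr K)) (hH : SatisfiesHeegnerHypothesis (W.conductorNorm ℤ) K)
    (h2K : ((Ideal.span {(2 : ℤ)}).primesOver (𝓞 K)).ncard = 2) (hTam : Odd W.tamagawaProduct)
    (h1 : Nat.card (W.selmerGroup 2) = 1)
    {Wd : WeierstrassCurve ℚ} [Wd.IsElliptic] (Cd : VariableChange ℚ) (hCd : Cd • W.quadraticTwist (discr K : ℚ) = Wd)
    (hDEF : padicValNat 2 Wd.tamagawaProduct = 0) (hSel : Nat.card (Wd.selmerGroup 2) = 2) :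
    ∃ c ∈ (Wd.kummerSelmerStructure ((2 : ℕ) : ℤ)).selmerGroup,
      galoisCohomology.localization (Wd.torsionGaloisModule ((2 : ℕ) : ℤ)) (Sum.inl Rat.infinitePlace) 1 c ≠ 0 := by
  -- a non-zero class of `Sel₂(Wd)` (it has two elements)
  have hSel' : Nat.card ((Wd.kummerSelmerStructure ((2 : ℕ) : ℤ)).selmerGroup) = 2 := by
    rw [← selmerGroup_eq_selmerGroup_kummerSelmerStructure, Nat.cast_ofNat]; exact hSel
  haveI : Finite ((Wd.kummerSelmerStructure ((2 : ℕ) : ℤ)).selmerGroup) := Nat.finite_of_card_ne_zero (by rw [hSel']; norm_num)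
  haveI : Nontrivial ((Wd.kummerSelmerStructure ((2 : ℕ) : ℤ)).selmerGroup) :=
    Finite.one_lt_card_iff_nontrivial.mp (by rw [hSel']; norm_num)
  obtain ⟨⟨c, hc⟩, hc0⟩ := exists_ne (0 : (Wd.kummerSelmerStructure ((2 : ℕ) : ℤ)).selmerGroup)
  refine ⟨c, hc, fun h0 ↦ hc0 (Subtype.ext ?_)⟩
  exact twin_selmer_eq_zero_of_localization_real_eq_zero W hK hodd hH h2K hTam h1 Cd hCd hDEF hc h0

end Rat

/-! ## §3 (appended, same seat) THE TWIN MEETS THE EGG: on the `#Sel₂(E) = 1` cell the all-silent twin has a rational point on its egg -/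

section Egg

variable (W : WeierstrassCurve ℚ) [W.IsElliptic] [W.IsGloballyMinimal] [NeZero (W.conductorNorm ℤ)]

/-- **CLAIM B⁺ READ ON POINTS: THE ALL-SILENT TWIN MEETS THE EGG.**  `W/ℚ` globally minimal with `Δ_W > 0`, `ρ̄_{W,2}` onto, `C(W)` odd and
`#Sel₂(W) = 1`; `K` imaginary quadratic with odd `d_K`, Heegner for `N_W`, `2` split in `K`, `τ ≠ 1`; a conductor-`1` Kolyvagin–Heegner frame
`(Dt, β, ι, d₁)` with `y_K = P(1)` of infinite order and `2^(M+1) ∤ P(1)` (any `M`), `w(W) = +1`; and an elliptic model `Wd ≅ W^(d_K)` with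
`#Sel₂(Wd) = 2` and `ord₂ C(Wd) = 0`.  Then **the twist `T = W^(d_K)` (the tree's model `W.quadraticTwist d_K`) has a rational point ON THE EGG**
(`F1Sign2.MeetsEgg T`: an affine point on the non-identity real component; `Δ_T > 0`).  Proof: `exists_twin_selmer_localization_real_ne_zero` for
the model `T` (its `2`-Selmer count is that of `Wd`) + gk2-p5 g10's dictionary `GenusKolyArch.meetsEgg_iff_exists_localization_inl_ne_zero`
(`Δ_T > 0`; `T(ℚ)[2] = 0` since `ρ̄_{T,2} = ρ̄_{W,2}` is onto; `Ш(T)[2] = 0` from gk2-p3 g27's frame `exists_frame_of_cut`).  READING for the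
instrument I1⁺: `T(ℚ) ≅ ℤ·g ⊕ (odd torsion)` with `g` ON the egg; the twin Heegner point `z = m·g + t` has `ord₂ m = M₀`, so
**`M₀ = 0 ⟺ z` lies on the egg (`x(z) <` the largest real root of the `2`-division cubic of `T`)** — an archimedean SIGN, replacing the vacuous
reduction bit R₁⁺ (p764449).  UNCONDITIONAL; BSD is NOT proved by this.
[cite: Kramer1981, §2 Prop. 6 (p. 127)] [cite: MazurRubin2010, Prop. 3.3, Cor. 3.4 (i)] [cite: GrossLMS1991, §5 Prop. 5.3] -/
theorem meetsEgg_twist_of_selmerTrivial_allSilent {K : Type} [Field K] [NumberField K]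
    (hpos : 0 < W.Δ) (hs2 : W.HasSurjectiveModNGaloisRep 2) (hTam : Odd W.tamagawaProduct) (h1 : Nat.card (W.selmerGroup 2) = 1)
    (hK : IsImaginaryQuadratic K) (hodd : Odd (discr K)) (hH : SatisfiesHeegnerHypothesis (W.conductorNorm ℤ) K)
    (h2K : ((Ideal.span {(2 : ℤ)}).primesOver (𝓞 K)).ncard = 2) {τ : K ≃ₐ[ℚ] K} (hτ : τ ≠ 1)
    (Dt : ModularForms.ModularParametrizationData W (W.conductorNorm ℤ)) (β : ℤ) (ι : K →+* ℂ) (d₁ : KolyvaginHeegnerData Dt β ι 1)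
    (hy : ¬ IsOfFinAddOrder d₁.derivedPoint) (M : ℕ)
    (hndiv : ¬ ∃ Q : (W.baseChange (ringClassField K ι 1)).toAffine.Point, ((2 ^ (M + 1) : ℕ) : ℤ) • Q = d₁.derivedPoint)
    (hw : W.rootNumber = 1)
    {Wd : WeierstrassCurve ℚ} [Wd.IsElliptic] (Cd : VariableChange ℚ) (hCd : Cd • W.quadraticTwist (discr K : ℚ) = Wd)
    (hSel : Nat.card (Wd.selmerGroup 2) = 2) (hDEF : padicValNat 2 Wd.tamagawaProduct = 0) :
    haveI := W.isElliptic_quadraticTwist (show (discr K : ℚ) ≠ 0 by exact_mod_cast NumberField.discr_ne_zero K)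
    Summit.BirchSwinnertonDyer.Rank1Residual.F1Sign2.MeetsEgg (W.quadraticTwist (discr K : ℚ)) := by
  haveI : Fact (Nat.Prime 2) := ⟨Nat.prime_two⟩
  have hd0 : (discr K : ℚ) ≠ 0 := by exact_mod_cast NumberField.discr_ne_zero K
  haveI hTell : (W.quadraticTwist (discr K : ℚ)).IsElliptic := W.isElliptic_quadraticTwist hd0
  set T := W.quadraticTwist (discr K : ℚ) with hTdef
  -- `rank W(ℚ) = 0` from `#Sel₂(W) = 1`
  have h1' : Nat.card (W.selmerGroup ((2 : ℕ) : ℤ)) = 1 := by rw [Nat.cast_ofNat]; exact h1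
  have hrk0 : W.mordellWeilRank = 0 :=
    (rank_eq_zero_and_torsionBy_eq_bot_and_sha_inf_torsionBy_eq_bot_of_natCard_selmerGroup_eq_one W 2 h1').1
  -- the frame: `Ш(T/ℚ)[2^∞] = 0`
  obtain ⟨-, -, -, hT0⟩ := exists_frame_of_cut W K hK hH hs2 hτ Dt β ι d₁ hy M hndiv hw hrk0 Wd ⟨Cd, hCd⟩ hSel
  have hSha : Summit.BirchSwinnertonDyer.Rank1Residual.F1Sign2.ShaTwoTrivial T := by
    intro c hc h2c
    have hmem : (⟨c, hc⟩ : ↥T.sha) ∈ AddCommGroup.primaryComponent (↥T.sha) 2 :=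
      (AddCommGroup.mem_primaryComponent).mpr ⟨1, Subtype.ext (by rw [pow_one, AddSubgroupClass.coe_nsmul, h2c, ZeroMemClass.coe_zero])⟩
    exact congrArg Subtype.val (hT0 _ hmem)
  -- `T(ℚ)[2] = 0`: `ρ̄_{T,2}` onto
  have hsT : T.HasSurjectiveModNGaloisRep ((2 : ℤ) ^ 1) := by
    rw [pow_one]
    exact (hasSurjectiveModNGaloisRep_two_quadraticTwist_iff W hd0).mpr hs2
  have hTors : Summit.BirchSwinnertonDyer.Rank1Residual.F1Sign2.NoRationalTwoTorsion T :=
    GenusKolyTwin.noRationalTwoTorsion_of_hasSurjectiveModNGaloisRep T hsT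
  -- `Δ_T > 0`
  have hΔT : 0 < T.Δ := by
    rw [hTdef, quadraticTwist_Δ]
    positivity
  -- `#Sel₂(T) = 2` (the model `T = 1 • T`) and `ord₂ C(T) = ord₂ C(Wd) = 0`
  have hSelT : Nat.card (T.selmerGroup 2) = 2 := by
    have h := natCard_selmerGroup_smul T Cd (n := 2) two_ne_zero
    simp only [Nat.cast_ofNat] at h
    rw [← h, hCd, hSel]
  have hDEFT : padicValNat 2 T.tamagawaProduct = 0 := by
    have h1T := prod_ncard_roots_add_one_eq_two_pow_padicValNat_tamagawaProduct_twin W hK hodd hH hTam (Wd := T) 1 (one_smul _ _)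
    have h2T := prod_ncard_roots_add_one_eq_two_pow_padicValNat_tamagawaProduct_twin W hK hodd hH hTam Cd hCd
    have heq : padicValNat 2 T.tamagawaProduct = padicValNat 2 Wd.tamagawaProduct :=
      Nat.pow_right_injective le_rfl (h1T.symm.trans h2T)
    rw [heq, hDEF]
  -- the non-trivial Selmer class of `T` lives at `∞`
  obtain ⟨c, hc, hne⟩ := exists_twin_selmer_localization_real_ne_zero W hK hodd hH h2K hTam h1 1 (one_smul _ _) hDEFT hSelT
  exact (GenusKolyArch.meetsEgg_iff_exists_localization_inl_ne_zero T hΔT hTors hSha).mpr ⟨c, hc, hne⟩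

end Egg

end Summit.BirchSwinnertonDyer.BirchSwinnertonDyer.Theorems.GenusSupplyNarrow.ArchBit

end
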